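import Literature.NumberTheory.GaloisCohomology.Howard2004.EigenSelmerDichotomyProofs
import Literature.NumberTheory.GaloisCohomology.Howard2004.TransverseConditionRingClassKernelProofs
import Literature.NumberTheory.GaloisCohomology.Howard2004.TransverseComplementOfCyclicProofs
import Literature.NumberTheory.GaloisCohomology.Howard2004.InertFrobeniusEigenvalueProofs
import Literature.NumberTheory.GaloisCohomology.Howard2004.FiniteSingularEvaluationLinearProofs
import Literature.Algebra.Module.EigenlineTransport
import HarnessLib

/-!
# Howard 2004, Lemma 1.5.3: the eigenLINES of the local complex conjugation `τ_q` on `H¹_tr(K_q, T̄)` and on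
# `H¹_f(K_q, T̄) = H¹_ur(K_q, T̄)` at an inert Kolyvagin prime (theorems only)

Topic `NumberTheory/GaloisCohomology/Howard2004`. THEOREMS ONLY: no definition, no named fact, no instance, no
notation, no `sorry`. Cell `pub/bsd-print-x9`, print leaf G87
`Literature.NumberTheory.GaloisCohomology.Howard2004.thm161_dvrKolyvaginBound`; seat `bsd-line-x10b-p1-w5` g8,
(EIG-LINES) — sequel to `EigenSelmerDichotomyProofs` (whose letters `hdecT` / `hline` it supplies) and to
`ResidualTauEvaluationProofs` / `InertFrobeniusEigenvalueProofs` (w5 g7: the evaluation dictionary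
`eval_γ (τ_q x) = θ(ρ̄(δ_q) eval_{φ'_q γ} x)`, «the local τ on `H¹_f(K_q, T̄) ≅ T̄` is `Θ_q = θ ∘ ρ̄(δ_q)`»).

SOURCE. B. Howard, *The Heegner point Kolyvagin system*, Compositio Math. **140** (2004) = arXiv:1202.6340,
Lemma 1.5.3, proof (p. 10 L12–16): «the action of complex conjugation splits `H¹_f(K_ℓ, T̄)` and `H¹_s(K_ℓ, T̄)` each into
one-dimensional eigenspaces by H.5 and the isomorphisms `H¹_f(K_ℓ, T̄) ≅ T̄ ≅ H¹_s(K_ℓ, T̄) ⊗ k^×` of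
Proposition 1.1.7»; Prop. 1.1.7 (p. 5 L129–141: evaluation at the Frobenius / at `σ_α`); H.5(a) (p. 7 L93–95).

WHAT IS PROVED (generic conjugation datum `cd`, inert `q` with `h : σ q = q`, trivial local action `htriv` on `T̄`,
`R` local with maximal ideal killing `T̄`, no `2`-torsion; `Θ_q := θ ∘ ρ̄(δ_q)` assumed to split `T̄` into an
H.5(a)-SHAPED pair of eigenvectors — `hΘ`, which IS H.5(a) when `ρ̄(δ_q) = 1` (`hΘ_of_h5a`), e.g. for the primes
produced by Lemma 1.6.2 with Frobenius in the class of `τ`):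
* §1 `evalClass_cast_eq` (place cast for evaluation), `ResidualTau.evalClass_thetaH1_transportH1_cast`
  (`eval_γ (τ_q x) = Θ_q (eval_{φ'_q γ} x)`, `φ'_q γ := (σq = q) ▸ φ_q γ`), `ResidualTau.hΘ_of_h5a`.
* §2 **`ResidualTau.transverse_eigen_decomposition_and_line`** — on `Lt = H¹_tr(K_q, T̄)`: with
  `Λ = Γ_{K_q} ∩ Γ_{K[ℓ]}` normal open, `Γ_{K_q} = ⟨σ₀⟩Λ` (`hcyc`), `d • T̄ = 0` when `σ₀^d ∈ Λ` (`hkill`), and the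
  DIHEDRAL letter `hdih : φ'_q(σ₀) · σ₀ ∈ Λ` (a lift of complex conjugation inverts `Gal(K[ℓ]_q/K_q)`): evaluation at
  `σ₀` is an isomorphism `Lt ≅ T̄` intertwining `τ_q` with `−Θ_q`, whence (i) `Lt = Lt⁺ + Lt⁻` elementwise and (ii) each
  `Lt^ε` (`ε = ±1`) is a LINE (`∃ r, b = r • v`) — VERBATIM the letters `hdecT` / `hline` of
  `EigenSelmerDichotomyProofs.map_inf_le_or_le_of_isotropic_of_eigen`.
* §3 **`ResidualTau.unramified_eigen_decomposition_and_line`** — the same on `Lf = H¹_ur(K_q, T̄)` via evaluation at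
  a Frobenius lift `γ₀` (Prop. 1.1.7, `evalClass_bijective_unramified`), intertwining `τ_q` with `+Θ_q` under the letter
  `hφγ : γ₀⁻¹ · φ'_q(γ₀) ∈ I_{K_q}` (the transport preserves the Frobenius coset) — inputs of the (GD-line) count.
The module-theoretic core is `Algebra/Module/EigenlineTransport.eigen_decomposition_and_line_of_eval`.

LETTERS KEPT (all about the datum at `q`, dischargeable for `ConjugationDatum.ofLifts`): `hdih`, `hφγ`, `hΘ`, and the
`τ_q`-stability of `H¹_tr` / `H¹_ur` (`TransportTransverseProofs`, `InertLocalTauUnramifiedProofs`).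
NOT HERE: the (GD-line) count itself; `thm161_dvrKolyvaginBound` is NOT proved; no summit statement is proved; the
Birch–Swinnerton-Dyer conjecture is not proved by any of this.
References: [Howard2004HeegnerKolyvagin] Lemma 1.5.3, Prop. 1.1.7, H.5(a); [MazurRubinMemoirs2004] Lemma 1.2.1;
[SerreGaloisCohomology1997] I §2.3.
-/

set_option autoImplicit false

noncomputable section

open Function NumberField IsDedekindDomain Field CategoryTheory
open scoped NumberField

namespace Literature.NumberTheory.GaloisCohomology.Howard2004

open Literature.NumberTheory.GaloisRepresentations
open Literature.NumberTheory.GaloisRepresentations.DiscreteGaloisModule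
open Literature.NumberTheory.EllipticCurves
open Literature.Algebra.Module

variable {K : Type} [Field K] [NumberField K] {Nbar : Type} [AddCommGroup Nbar]
  [TopologicalSpace Nbar] [DiscreteTopology Nbar] {R : Type} [CommRing R] [Module R Nbar]
  {cd : ConjugationDatum K} {ρbar : DiscreteGaloisModule K Nbar}

/-! ## §1 Place casts for evaluation of LOCAL classes -/

/-- Evaluation of a local class transported along `e : w = v`: evaluating `e.symm ▸ x` at `g ∈ Γ_{K_w}` is evaluating `x`
at `e ▸ g ∈ Γ_{K_v}`. [cite: Howard2004HeegnerKolyvagin, §1.3 (arXiv p. 7 L44–48, read at a degree-two prime `λ̄ = λ`)] -/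
theorem evalClass_cast_eq (ρbar : DiscreteGaloisModule K Nbar) {v w : HeightOneSpectrum (𝓞 K)} (e : w = v)
    (htv : ∀ (σ : absoluteGaloisGroup (v.adicCompletion K)) (x : Nbar), GaloisRep.toLocal v ρbar σ x = x)
    (htw : ∀ (σ : absoluteGaloisGroup (w.adicCompletion K)) (x : Nbar), GaloisRep.toLocal w ρbar σ x = x)
    (g : absoluteGaloisGroup (w.adicCompletion K)) (x : galoisCohomology (ρbar.toLocal (Sum.inr v)) 1) :
    evalClass (GaloisRep.toLocal w ρbar) htw g (e.symm ▸ x : galoisCohomology (ρbar.toLocal (Sum.inr w)) 1) =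
      evalClass (GaloisRep.toLocal v ρbar) htv (e ▸ g : absoluteGaloisGroup (v.adicCompletion K)) x := by
  subst e
  rfl

namespace ResidualTau

variable (A : ResidualTau (R := R) cd ρbar) (hρ : ρbar.IsScalarLinear R) {q : HeightOneSpectrum (𝓞 K)}
  (h : cd.σ • q = q)

/-- **`eval_γ (τ_q x) = Θ_q (eval_{φ'_q γ} x)`** at an inert prime, `Θ_q := θ ∘ ρ̄(δ_q)`, `φ'_q γ := (σq = q) ▸ φ_q γ`
(the evaluation dictionary `ResidualTauEvaluationProofs.evalClass_thetaH1_transportH1` with the place cast).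
[cite: Howard2004HeegnerKolyvagin, §1.3 (arXiv p. 7 L44–48) with Prop. 1.1.7 (p. 5 L137–138)] -/
theorem evalClass_thetaH1_transportH1_cast
    (htriv : ∀ (σ : absoluteGaloisGroup (q.adicCompletion K)) (x : Nbar), GaloisRep.toLocal q ρbar σ x = x)
    (γ : absoluteGaloisGroup (q.adicCompletion K))
    (x : galoisCohomology (ρbar.toLocal (Sum.inr q)) 1) :
    evalClass (GaloisRep.toLocal q ρbar) htriv γ (A.thetaH1 (Sum.inr q) (cd.transportH1 ρbar q
        (h.symm ▸ x : galoisCohomology (ρbar.toLocal (Sum.inr (cd.σ • q))) 1))) =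
      A.θ (ρbar (cd.δ q) (evalClass (GaloisRep.toLocal q ρbar) htriv
        (h ▸ cd.φ q γ : absoluteGaloisGroup (q.adicCompletion K)) x)) := by
  rw [A.evalClass_thetaH1_transportH1 q htriv (trivial_of_eq ρbar h htriv) γ,
    evalClass_cast_eq ρbar h htriv (trivial_of_eq ρbar h htriv) (cd.φ q γ) x]

/-- **`hΘ` is H.5(a) when `ρ̄(δ_q) = 1`**: if the inner correction of the datum at `q` acts trivially on `T̄`, the
H.5(a)-shaped hypothesis on `Θ_q = θ ∘ ρ̄(δ_q)` of the theorems below is Howard's H.5(a) for `θ` verbatim (`H5a A`).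
[cite: Howard2004HeegnerKolyvagin, §1.3 H.5(a) (arXiv p. 7 L93–95)] -/
theorem hΘ_of_h5a (hδ : ∀ x : Nbar, ρbar (cd.δ q) x = x) (h5a : H5a (R := R) A) :
    ∃ xp : Nbar, xp ≠ 0 ∧ A.θ (ρbar (cd.δ q) xp) = xp ∧ ∃ xm : Nbar, xm ≠ 0 ∧ A.θ (ρbar (cd.δ q) xm) = -xm ∧
      ∀ x : Nbar, ∃ a b : R, x = a • xp + b • xm := by
  obtain ⟨xp, hxp0, hxp, xm, hxm0, hxm, hspan⟩ := h5a
  exact ⟨xp, hxp0, by rw [hδ, hxp], xm, hxm0, by rw [hδ, hxm], hspan⟩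

/-! ## §2 The eigenLINES of `τ_q` on `H¹_tr(K_q, T̄)` -/

/-- **The `τ_q`-eigenline structure of the transverse condition at an inert Kolyvagin prime.** Let `q` be inert
(`h : σ q = q`) with trivial local action on the `p`-primary `T̄`, `Λ = Γ_{K_q} ∩ Γ_{K[ℓ]}` (normal, open) with
`Γ_{K_q} = ⟨σ₀⟩ Λ` (`hcyc`) and `d • T̄ = 0` whenever `σ₀^d ∈ Λ` (`hkill`), and suppose the local transport INVERTS
`σ₀` modulo `Λ` (`hdih : φ'_q(σ₀) · σ₀ ∈ Λ` — `K[ℓ]/ℚ` is generalised dihedral). If `Θ_q := θ ∘ ρ̄(δ_q)` splits `T̄`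
into an H.5(a)-shaped pair of eigenvectors (`hΘ`; `= H.5(a)` when `ρ̄(δ_q) = 1`), `R` is local with maximal ideal
killing `T̄` and `T̄` has no `2`-torsion, then, `Lt := H¹_tr(K_q, T̄)` being `τ_q`- and `R`-stable:
(i) every `b ∈ Lt` is `b₁ + b₂` with `b₁, b₂ ∈ Lt`, `τ_q b₁ = b₁`, `τ_q b₂ = −b₂`; (ii) for `ε = ±1` the
`ε`-eigenpart of `Lt` is a LINE: every `ε`-eigenclass in `Lt` is `r • v` for any fixed non-zero one. (Evaluation at
`σ₀` is an isomorphism `Lt ≅ T̄` intertwining `τ_q` with `−Θ_q`.) These are the letters `hdecT` / `hline` of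
`EigenSelmerDichotomyProofs.map_inf_le_or_le_of_isotropic_of_eigen`.
[cite: Howard2004HeegnerKolyvagin, Lemma 1.5.3 proof (arXiv p. 10 L12–16: «the action of complex conjugation splits `H¹_f(K_ℓ, T̄)` and `H¹_s(K_ℓ, T̄)` each into one-dimensional eigenspaces by H.5 and the isomorphisms … of Proposition 1.1.7») and Prop. 1.1.7 (p. 5 L129–141)] -/
theorem transverse_eigen_decomposition_and_line [IsLocalRing R]
    (htriv : ∀ (σ : absoluteGaloisGroup (q.adicCompletion K)) (x : Nbar), GaloisRep.toLocal q ρbar σ x = x)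
    {p : ℕ} [Fact p.Prime] (ℓ : ℕ)
    (jbar : AlgebraicClosure K →+* ℂ) [(localRingClassSubgroup ℓ jbar q).Normal]
    (hΛ : IsOpen (localRingClassSubgroup ℓ jbar q : Set (absoluteGaloisGroup (q.adicCompletion K))))
    (hp : ∀ x : Nbar, ∃ n : ℕ, p ^ n • x = 0) (σ₀ : absoluteGaloisGroup (q.adicCompletion K))
    (hcyc : ∀ σ : absoluteGaloisGroup (q.adicCompletion K), ∃ j : ℕ, (σ₀ ^ j)⁻¹ * σ ∈ localRingClassSubgroup ℓ jbar q)
    (hkill : ∀ d : ℕ, σ₀ ^ d ∈ localRingClassSubgroup ℓ jbar q → ∀ t : Nbar, d • t = 0)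
    (hdih : (h ▸ cd.φ q σ₀ : absoluteGaloisGroup (q.adicCompletion K)) * σ₀ ∈ localRingClassSubgroup ℓ jbar q)
    (hΘ : ∃ xp : Nbar, xp ≠ 0 ∧ A.θ (ρbar (cd.δ q) xp) = xp ∧ ∃ xm : Nbar, xm ≠ 0 ∧ A.θ (ρbar (cd.δ q) xm) = -xm ∧
      ∀ x : Nbar, ∃ a b : R, x = a • xp + b • xm)
    (hm : ∀ a ∈ IsLocalRing.maximalIdeal R, ∀ x : Nbar, a • x = 0) (h2 : ∀ x : Nbar, 2 • x = 0 → x = 0)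
    (hLt : ∀ (r : R), ∀ x ∈ transverseCondition p ρbar ℓ jbar q,
      galoisCohomology.scalarMapH1 (ρbar.toLocal (Sum.inr q)) (DualityDatum.isScalarLinear_toLocal hρ (Sum.inr q)) r x ∈
        transverseCondition p ρbar ℓ jbar q)
    (hstabt : ∀ x ∈ transverseCondition p ρbar ℓ jbar q, A.thetaH1 (Sum.inr q) (cd.transportH1 ρbar q
        (h.symm ▸ x : galoisCohomology (ρbar.toLocal (Sum.inr (cd.σ • q))) 1)) ∈ transverseCondition p ρbar ℓ jbar q) :
    (∀ b ∈ transverseCondition p ρbar ℓ jbar q, ∃ b₁ ∈ transverseCondition p ρbar ℓ jbar q,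
      ∃ b₂ ∈ transverseCondition p ρbar ℓ jbar q,
        A.thetaH1 (Sum.inr q) (cd.transportH1 ρbar q
            (h.symm ▸ b₁ : galoisCohomology (ρbar.toLocal (Sum.inr (cd.σ • q))) 1)) = b₁ ∧
          A.thetaH1 (Sum.inr q) (cd.transportH1 ρbar q
            (h.symm ▸ b₂ : galoisCohomology (ρbar.toLocal (Sum.inr (cd.σ • q))) 1)) = -b₂ ∧ b = b₁ + b₂) ∧
    (∀ ε : ℤ, ε = 1 ∨ ε = -1 → ∀ v ∈ transverseCondition p ρbar ℓ jbar q,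
      A.thetaH1 (Sum.inr q) (cd.transportH1 ρbar q
          (h.symm ▸ v : galoisCohomology (ρbar.toLocal (Sum.inr (cd.σ • q))) 1)) = ε • v → v ≠ 0 →
        ∀ b ∈ transverseCondition p ρbar ℓ jbar q,
          A.thetaH1 (Sum.inr q) (cd.transportH1 ρbar q
            (h.symm ▸ b : galoisCohomology (ρbar.toLocal (Sum.inr (cd.σ • q))) 1)) = ε • b →
          ∃ r : R, b = galoisCohomology.scalarMapH1 (ρbar.toLocal (Sum.inr q))
            (DualityDatum.isScalarLinear_toLocal hρ (Sum.inr q)) r v) := by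
  -- the data of the core lemma
  let τ : galoisCohomology (ρbar.toLocal (Sum.inr q)) 1 →+ galoisCohomology (ρbar.toLocal (Sum.inr q)) 1 :=
    AddMonoidHom.mk' (fun y => A.thetaH1 (Sum.inr q) (cd.transportH1 ρbar q
        (h.symm ▸ y : galoisCohomology (ρbar.toLocal (Sum.inr (cd.σ • q))) 1)))
      (A.thetaH1_transportH1_cast_add h)
  have hτ : ∀ y, τ y = A.thetaH1 (Sum.inr q) (cd.transportH1 ρbar q
      (h.symm ▸ y : galoisCohomology (ρbar.toLocal (Sum.inr (cd.σ • q))) 1)) := fun _ => rfl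
  let ev : galoisCohomology (ρbar.toLocal (Sum.inr q)) 1 →+ Nbar := evalClass (GaloisRep.toLocal q ρbar) htriv σ₀
  let Θ : Nbar →ₗ[R] Nbar :=
    { toFun := fun x => A.θ (ρbar (cd.δ q) x)
      map_add' := fun x y => by rw [map_add, map_add]
      map_smul' := fun r x => by rw [hρ (cd.δ q) r x, map_smul, RingHom.id_apply] }
  have hΘ' : ∃ xp : Nbar, xp ≠ 0 ∧ Θ xp = xp ∧ ∃ xm : Nbar, xm ≠ 0 ∧ Θ xm = -xm ∧
      ∀ x : Nbar, ∃ a b : R, x = a • xp + b • xm := hΘ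
  -- membership in `H¹_tr` = vanishing on `Λ`
  have hmem : ∀ z : contOneCocycles (DiscreteGaloisModule.toTopRep (GaloisRep.toLocal q ρbar)),
      oneCocycleClass _ z ∈ transverseCondition p ρbar ℓ jbar q ↔
        ∀ g ∈ localRingClassSubgroup ℓ jbar q, z.1 g = 0 :=
    fun z => oneCocycleClass_mem_transverseCondition_iff_forall_localRingClassSubgroup p ρbar ℓ jbar q htriv hp z
  -- injectivity of `ev` on `Lt`
  have hinj : ∀ x ∈ transverseCondition p ρbar ℓ jbar q, ev x = 0 → x = 0 := by
    intro x hx h0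
    obtain ⟨z, rfl⟩ := oneCocycleClass_surjective _ x
    have hz : ∀ g ∈ localRingClassSubgroup ℓ jbar q, z.1 g = 0 := (hmem z).mp hx
    have h0' : z.1 σ₀ = 0 := by
      rw [← evalClass_oneCocycleClass (GaloisRep.toLocal q ρbar) htriv σ₀ z]; exact h0
    have hzero : ∀ σ, z.1 σ = 0 := by
      intro σ
      obtain ⟨j, hj⟩ := hcyc σ
      have hσ : σ = σ₀ ^ j * ((σ₀ ^ j)⁻¹ * σ) := by rw [mul_inv_cancel_left]
      rw [hσ, cocycle_apply_mul (GaloisRep.toLocal q ρbar) htriv, hz _ hj, add_zero,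
        cocycle_apply_pow (GaloisRep.toLocal q ρbar) htriv, h0', smul_zero]
    have : z = 0 := Subtype.ext (ContinuousMap.ext hzero)
    rw [this]
    exact map_zero (oneCocycleClassₗ _)
  -- surjectivity of `ev` on `Lt`
  have hsurj : ∀ t : Nbar, ∃ x ∈ transverseCondition p ρbar ℓ jbar q, ev x = t := by
    intro t
    obtain ⟨c, hc, hct⟩ := exists_resSubgroup_eq_zero_and_evalClass_eq (GaloisRep.toLocal q ρbar) htriv
      (localRingClassSubgroup ℓ jbar q) hΛ σ₀ hcyc t (fun d hd => hkill d hd t)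
    refine ⟨c, ?_, hct⟩
    rw [transverseCondition_eq_ker_resSubgroup_localRingClassSubgroup p ρbar ℓ jbar q htriv hp]
    exact hc
  -- `ev ∘ τ_q = −Θ_q ∘ ev` on `Lt` (the transport inverts `σ₀` modulo `Λ`)
  have hτev : ∀ x ∈ transverseCondition p ρbar ℓ jbar q, ev (τ x) = (-1 : ℤ) • Θ (ev x) := by
    intro x hx
    obtain ⟨z, rfl⟩ := oneCocycleClass_surjective _ x
    have hz : ∀ g ∈ localRingClassSubgroup ℓ jbar q, z.1 g = 0 := (hmem z).mp hx
    rw [hτ, neg_one_zsmul]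
    change evalClass (GaloisRep.toLocal q ρbar) htriv σ₀ _ = -A.θ (ρbar (cd.δ q)
      (evalClass (GaloisRep.toLocal q ρbar) htriv σ₀ (oneCocycleClass _ z)))
    rw [A.evalClass_thetaH1_transportH1_cast h htriv σ₀, evalClass_oneCocycleClass, evalClass_oneCocycleClass]
    -- `z(φ'σ₀) = z(φ'σ₀ σ₀ · σ₀⁻¹) = −z(σ₀)`
    have hval : z.1 (h ▸ cd.φ q σ₀ : absoluteGaloisGroup (q.adicCompletion K)) = -z.1 σ₀ := by
      have e1 : (h ▸ cd.φ q σ₀ : absoluteGaloisGroup (q.adicCompletion K)) =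
          ((h ▸ cd.φ q σ₀ : absoluteGaloisGroup (q.adicCompletion K)) * σ₀) * σ₀⁻¹ := by
        rw [mul_inv_cancel_right]
      rw [e1, cocycle_apply_mul (GaloisRep.toLocal q ρbar) htriv, hz _ hdih, zero_add,
        cocycle_apply_inv (GaloisRep.toLocal q ρbar) htriv]
    rw [hval, map_neg, map_neg]
  have key := eigen_decomposition_and_line_of_eval
    (fun r => galoisCohomology.scalarMapH1 (ρbar.toLocal (Sum.inr q)) (DualityDatum.isScalarLinear_toLocal hρ (Sum.inr q)) r)
    (transverseCondition p ρbar ℓ jbar q) hLt τ hstabt ev hinj hsurj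
    (fun r x => evalClass_scalarMapH1 (GaloisRep.toLocal q ρbar) htriv
      (DualityDatum.isScalarLinear_toLocal hρ (Sum.inr q)) σ₀ r x)
    Θ (Or.inr rfl) hτev hΘ' hm h2
  exact key

/-! ## §3 The eigenLINES of `τ_q` on `H¹_ur(K_q, T̄) = H¹_f(K_q, T̄)` -/

/-- **The `τ_q`-eigenline structure of the unramified (finite) condition at an inert Kolyvagin prime.** Let `q` be
inert (`h : σ q = q`) with trivial local action on the finite `T̄`, `γ₀` an arithmetic Frobenius lift whose transport
`φ'_q(γ₀)` is again a Frobenius lift (`hφγ : γ₀⁻¹ · φ'_q(γ₀) ∈ I_{K_q}` — field automorphisms preserve the Frobenius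
coset). If `Θ_q := θ ∘ ρ̄(δ_q)` splits `T̄` into an H.5(a)-shaped pair of eigenvectors, `R` is local with maximal ideal
killing `T̄` and `T̄` has no `2`-torsion, then, `Lf := H¹_ur(K_q, T̄)` being `τ_q`-stable: (i) every `u ∈ Lf` is
`u₁ + u₂` with `u₁, u₂ ∈ Lf`, `τ_q u₁ = u₁`, `τ_q u₂ = −u₂`; (ii) for `ε = ±1` the `ε`-eigenpart of `Lf` is a LINE.
(Evaluation at `γ₀` is an isomorphism `Lf ≅ T̄` intertwining `τ_q` with `Θ_q`: Prop. 1.1.7 +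
`ResidualTauEvaluationProofs`.) The `Lf` twins of the letters `hdecT` / `hline`, inputs of the (GD-line) count.
[cite: Howard2004HeegnerKolyvagin, Lemma 1.5.3 proof (arXiv p. 10 L12–16) and Prop. 1.1.7 (p. 5 L129–138)] -/
theorem unramified_eigen_decomposition_and_line [IsLocalRing R] [Finite Nbar]
    (htriv : ∀ (σ : absoluteGaloisGroup (q.adicCompletion K)) (x : Nbar), GaloisRep.toLocal q ρbar σ x = x)
    (γ₀ : absoluteGaloisGroup (q.adicCompletion K)) (hγ₀ : IsFrobPow γ₀ 1)
    (hφγ : γ₀⁻¹ * (h ▸ cd.φ q γ₀ : absoluteGaloisGroup (q.adicCompletion K)) ∈ absInertia (q.adicCompletion K))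
    (hΘ : ∃ xp : Nbar, xp ≠ 0 ∧ A.θ (ρbar (cd.δ q) xp) = xp ∧ ∃ xm : Nbar, xm ≠ 0 ∧ A.θ (ρbar (cd.δ q) xm) = -xm ∧
      ∀ x : Nbar, ∃ a b : R, x = a • xp + b • xm)
    (hm : ∀ a ∈ IsLocalRing.maximalIdeal R, ∀ x : Nbar, a • x = 0) (h2 : ∀ x : Nbar, 2 • x = 0 → x = 0)
    (hstabf : ∀ x ∈ unramifiedSubgroup (GaloisRep.toLocal q ρbar) 1, A.thetaH1 (Sum.inr q) (cd.transportH1 ρbar q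
        (h.symm ▸ x : galoisCohomology (ρbar.toLocal (Sum.inr (cd.σ • q))) 1)) ∈
          unramifiedSubgroup (GaloisRep.toLocal q ρbar) 1) :
    (∀ b ∈ unramifiedSubgroup (GaloisRep.toLocal q ρbar) 1, ∃ b₁ ∈ unramifiedSubgroup (GaloisRep.toLocal q ρbar) 1,
      ∃ b₂ ∈ unramifiedSubgroup (GaloisRep.toLocal q ρbar) 1,
        A.thetaH1 (Sum.inr q) (cd.transportH1 ρbar q
            (h.symm ▸ b₁ : galoisCohomology (ρbar.toLocal (Sum.inr (cd.σ • q))) 1)) = b₁ ∧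
          A.thetaH1 (Sum.inr q) (cd.transportH1 ρbar q
            (h.symm ▸ b₂ : galoisCohomology (ρbar.toLocal (Sum.inr (cd.σ • q))) 1)) = -b₂ ∧ b = b₁ + b₂) ∧
    (∀ ε : ℤ, ε = 1 ∨ ε = -1 → ∀ v ∈ unramifiedSubgroup (GaloisRep.toLocal q ρbar) 1,
      A.thetaH1 (Sum.inr q) (cd.transportH1 ρbar q
          (h.symm ▸ v : galoisCohomology (ρbar.toLocal (Sum.inr (cd.σ • q))) 1)) = ε • v → v ≠ 0 →
        ∀ b ∈ unramifiedSubgroup (GaloisRep.toLocal q ρbar) 1,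
          A.thetaH1 (Sum.inr q) (cd.transportH1 ρbar q
            (h.symm ▸ b : galoisCohomology (ρbar.toLocal (Sum.inr (cd.σ • q))) 1)) = ε • b →
          ∃ r : R, b = galoisCohomology.scalarMapH1 (ρbar.toLocal (Sum.inr q))
            (DualityDatum.isScalarLinear_toLocal hρ (Sum.inr q)) r v) := by
  let τ : galoisCohomology (ρbar.toLocal (Sum.inr q)) 1 →+ galoisCohomology (ρbar.toLocal (Sum.inr q)) 1 :=
    AddMonoidHom.mk' (fun y => A.thetaH1 (Sum.inr q) (cd.transportH1 ρbar q
        (h.symm ▸ y : galoisCohomology (ρbar.toLocal (Sum.inr (cd.σ • q))) 1)))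
      (A.thetaH1_transportH1_cast_add h)
  have hτ : ∀ y, τ y = A.thetaH1 (Sum.inr q) (cd.transportH1 ρbar q
      (h.symm ▸ y : galoisCohomology (ρbar.toLocal (Sum.inr (cd.σ • q))) 1)) := fun _ => rfl
  let ev : galoisCohomology (ρbar.toLocal (Sum.inr q)) 1 →+ Nbar := evalClass (GaloisRep.toLocal q ρbar) htriv γ₀
  let Θ : Nbar →ₗ[R] Nbar :=
    { toFun := fun x => A.θ (ρbar (cd.δ q) x)
      map_add' := fun x y => by rw [map_add, map_add]
      map_smul' := fun r x => by rw [hρ (cd.δ q) r x, map_smul, RingHom.id_apply] }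
  have hΘ' : ∃ xp : Nbar, xp ≠ 0 ∧ Θ xp = xp ∧ ∃ xm : Nbar, xm ≠ 0 ∧ Θ xm = -xm ∧
      ∀ x : Nbar, ∃ a b : R, x = a • xp + b • xm := hΘ
  have hinj : ∀ x ∈ unramifiedSubgroup (GaloisRep.toLocal q ρbar) 1, ev x = 0 → x = 0 :=
    fun x hx h0 => evalClass_eq_zero_of_mem_unramified (GaloisRep.toLocal q ρbar) htriv hγ₀ hx h0
  have hsurj : ∀ t : Nbar, ∃ x ∈ unramifiedSubgroup (GaloisRep.toLocal q ρbar) 1, ev x = t :=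
    fun t => exists_mem_unramified_evalClass_eq (GaloisRep.toLocal q ρbar) htriv hγ₀ t
  -- `ev ∘ τ_q = Θ_q ∘ ev` on `Lf` (the transport preserves the Frobenius coset)
  have hτev : ∀ x ∈ unramifiedSubgroup (GaloisRep.toLocal q ρbar) 1, ev (τ x) = (1 : ℤ) • Θ (ev x) := by
    intro x hx
    rw [hτ, one_zsmul]
    change evalClass (GaloisRep.toLocal q ρbar) htriv γ₀ _ = A.θ (ρbar (cd.δ q)
      (evalClass (GaloisRep.toLocal q ρbar) htriv γ₀ x))
    rw [A.evalClass_thetaH1_transportH1_cast h htriv γ₀,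
      evalClass_eq_of_mem_unramified (GaloisRep.toLocal q ρbar) htriv hφγ hx]
  have key := eigen_decomposition_and_line_of_eval
    (fun r => galoisCohomology.scalarMapH1 (ρbar.toLocal (Sum.inr q)) (DualityDatum.isScalarLinear_toLocal hρ (Sum.inr q)) r)
    (unramifiedSubgroup (GaloisRep.toLocal q ρbar) 1)
    (fun r x hx => DiscreteGaloisModule.scalarMapH1_mem_unramifiedSubgroup (ρ := GaloisRep.toLocal q ρbar)
      (DualityDatum.isScalarLinear_toLocal hρ (Sum.inr q)) r hx)
    τ hstabf ev hinj hsurj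
    (fun r x => evalClass_scalarMapH1 (GaloisRep.toLocal q ρbar) htriv
      (DualityDatum.isScalarLinear_toLocal hρ (Sum.inr q)) γ₀ r x)
    Θ (Or.inl rfl) hτev hΘ' hm h2
  exact key

/-! ## §4 Both eigenlines are non-zero (the eigenparts of `H¹_tr`, `H¹_ur` are LINES, not `0`) -/

/-- **Non-zero `τ_q`-eigenclasses in `H¹_tr(K_q, T̄)` of both signs** (same hypotheses as
`transverse_eigen_decomposition_and_line`, minus the stabilities): for `ε = ±1` there is `v ∈ H¹_tr(K_q, T̄)`, `v ≠ 0`,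
with `τ_q v = ε • v` — the lift along evaluation at `σ₀` of the H.5(a)-eigenvector of `Θ_q` of sign `−ε`.
[cite: Howard2004HeegnerKolyvagin, Lemma 1.5.3 proof (arXiv p. 10 L12–16: «one-dimensional eigenspaces») and Prop. 1.1.7 (p. 5 L138–141)] -/
theorem transverse_exists_eigenclass_ne_zero (hρ : ρbar.IsScalarLinear R)
    (htriv : ∀ (σ : absoluteGaloisGroup (q.adicCompletion K)) (x : Nbar), GaloisRep.toLocal q ρbar σ x = x)
    {p : ℕ} [Fact p.Prime] (ℓ : ℕ)
    (jbar : AlgebraicClosure K →+* ℂ) [(localRingClassSubgroup ℓ jbar q).Normal]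
    (hΛ : IsOpen (localRingClassSubgroup ℓ jbar q : Set (absoluteGaloisGroup (q.adicCompletion K))))
    (hp : ∀ x : Nbar, ∃ n : ℕ, p ^ n • x = 0) (σ₀ : absoluteGaloisGroup (q.adicCompletion K))
    (hcyc : ∀ σ : absoluteGaloisGroup (q.adicCompletion K), ∃ j : ℕ, (σ₀ ^ j)⁻¹ * σ ∈ localRingClassSubgroup ℓ jbar q)
    (hkill : ∀ d : ℕ, σ₀ ^ d ∈ localRingClassSubgroup ℓ jbar q → ∀ t : Nbar, d • t = 0)
    (hdih : (h ▸ cd.φ q σ₀ : absoluteGaloisGroup (q.adicCompletion K)) * σ₀ ∈ localRingClassSubgroup ℓ jbar q)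
    (hΘ : ∃ xp : Nbar, xp ≠ 0 ∧ A.θ (ρbar (cd.δ q) xp) = xp ∧ ∃ xm : Nbar, xm ≠ 0 ∧ A.θ (ρbar (cd.δ q) xm) = -xm ∧
      ∀ x : Nbar, ∃ a b : R, x = a • xp + b • xm)
    (hstabt : ∀ x ∈ transverseCondition p ρbar ℓ jbar q, A.thetaH1 (Sum.inr q) (cd.transportH1 ρbar q
        (h.symm ▸ x : galoisCohomology (ρbar.toLocal (Sum.inr (cd.σ • q))) 1)) ∈ transverseCondition p ρbar ℓ jbar q)
    {ε : ℤ} (hε : ε = 1 ∨ ε = -1) :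
    ∃ v ∈ transverseCondition p ρbar ℓ jbar q, v ≠ 0 ∧
      A.thetaH1 (Sum.inr q) (cd.transportH1 ρbar q
        (h.symm ▸ v : galoisCohomology (ρbar.toLocal (Sum.inr (cd.σ • q))) 1)) = ε • v := by
  let τ : galoisCohomology (ρbar.toLocal (Sum.inr q)) 1 →+ galoisCohomology (ρbar.toLocal (Sum.inr q)) 1 :=
    AddMonoidHom.mk' (fun y => A.thetaH1 (Sum.inr q) (cd.transportH1 ρbar q
        (h.symm ▸ y : galoisCohomology (ρbar.toLocal (Sum.inr (cd.σ • q))) 1)))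
      (A.thetaH1_transportH1_cast_add h)
  have hτ : ∀ y, τ y = A.thetaH1 (Sum.inr q) (cd.transportH1 ρbar q
      (h.symm ▸ y : galoisCohomology (ρbar.toLocal (Sum.inr (cd.σ • q))) 1)) := fun _ => rfl
  let ev : galoisCohomology (ρbar.toLocal (Sum.inr q)) 1 →+ Nbar := evalClass (GaloisRep.toLocal q ρbar) htriv σ₀
  let Θ : Nbar →ₗ[R] Nbar :=
    { toFun := fun x => A.θ (ρbar (cd.δ q) x)
      map_add' := fun x y => by rw [map_add, map_add]
      map_smul' := fun r x => by rw [hρ (cd.δ q) r x, map_smul, RingHom.id_apply] }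
  have hΘ' : ∃ xp : Nbar, xp ≠ 0 ∧ Θ xp = xp ∧ ∃ xm : Nbar, xm ≠ 0 ∧ Θ xm = -xm ∧
      ∀ x : Nbar, ∃ a b : R, x = a • xp + b • xm := hΘ
  have hmem : ∀ z : contOneCocycles (DiscreteGaloisModule.toTopRep (GaloisRep.toLocal q ρbar)),
      oneCocycleClass _ z ∈ transverseCondition p ρbar ℓ jbar q ↔
        ∀ g ∈ localRingClassSubgroup ℓ jbar q, z.1 g = 0 :=
    fun z => oneCocycleClass_mem_transverseCondition_iff_forall_localRingClassSubgroup p ρbar ℓ jbar q htriv hp z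
  have hinj : ∀ x ∈ transverseCondition p ρbar ℓ jbar q, ev x = 0 → x = 0 := by
    intro x hx h0
    obtain ⟨z, rfl⟩ := oneCocycleClass_surjective _ x
    have hz : ∀ g ∈ localRingClassSubgroup ℓ jbar q, z.1 g = 0 := (hmem z).mp hx
    have h0' : z.1 σ₀ = 0 := by
      rw [← evalClass_oneCocycleClass (GaloisRep.toLocal q ρbar) htriv σ₀ z]; exact h0
    have hzero : ∀ σ, z.1 σ = 0 := by
      intro σ
      obtain ⟨j, hj⟩ := hcyc σ
      have hσ : σ = σ₀ ^ j * ((σ₀ ^ j)⁻¹ * σ) := by rw [mul_inv_cancel_left]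
      rw [hσ, cocycle_apply_mul (GaloisRep.toLocal q ρbar) htriv, hz _ hj, add_zero,
        cocycle_apply_pow (GaloisRep.toLocal q ρbar) htriv, h0', smul_zero]
    have : z = 0 := Subtype.ext (ContinuousMap.ext hzero)
    rw [this]
    exact map_zero (oneCocycleClassₗ _)
  have hsurj : ∀ t : Nbar, ∃ x ∈ transverseCondition p ρbar ℓ jbar q, ev x = t := by
    intro t
    obtain ⟨c, hc, hct⟩ := exists_resSubgroup_eq_zero_and_evalClass_eq (GaloisRep.toLocal q ρbar) htriv
      (localRingClassSubgroup ℓ jbar q) hΛ σ₀ hcyc t (fun d hd => hkill d hd t)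
    refine ⟨c, ?_, hct⟩
    rw [transverseCondition_eq_ker_resSubgroup_localRingClassSubgroup p ρbar ℓ jbar q htriv hp]
    exact hc
  have hτev : ∀ x ∈ transverseCondition p ρbar ℓ jbar q, ev (τ x) = (-1 : ℤ) • Θ (ev x) := by
    intro x hx
    obtain ⟨z, rfl⟩ := oneCocycleClass_surjective _ x
    have hz : ∀ g ∈ localRingClassSubgroup ℓ jbar q, z.1 g = 0 := (hmem z).mp hx
    rw [hτ, neg_one_zsmul]
    change evalClass (GaloisRep.toLocal q ρbar) htriv σ₀ _ = -A.θ (ρbar (cd.δ q)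
      (evalClass (GaloisRep.toLocal q ρbar) htriv σ₀ (oneCocycleClass _ z)))
    rw [A.evalClass_thetaH1_transportH1_cast h htriv σ₀, evalClass_oneCocycleClass, evalClass_oneCocycleClass]
    have hval : z.1 (h ▸ cd.φ q σ₀ : absoluteGaloisGroup (q.adicCompletion K)) = -z.1 σ₀ := by
      have e1 : (h ▸ cd.φ q σ₀ : absoluteGaloisGroup (q.adicCompletion K)) =
          ((h ▸ cd.φ q σ₀ : absoluteGaloisGroup (q.adicCompletion K)) * σ₀) * σ₀⁻¹ := by
        rw [mul_inv_cancel_right]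
      rw [e1, cocycle_apply_mul (GaloisRep.toLocal q ρbar) htriv, hz _ hdih, zero_add,
        cocycle_apply_inv (GaloisRep.toLocal q ρbar) htriv]
    rw [hval, map_neg, map_neg]
  obtain ⟨v, hv, hv0, hτv⟩ := exists_eigenvector_ne_zero_of_eval (transverseCondition p ρbar ℓ jbar q) τ hstabt ev hinj hsurj
    Θ (Or.inr rfl) hτev hΘ' hε
  exact ⟨v, hv, hv0, hτv⟩

/-- **Non-zero `τ_q`-eigenclasses in `H¹_ur(K_q, T̄)` of both signs** (hypotheses of
`unramified_eigen_decomposition_and_line`): for `ε = ±1` there is `v ∈ H¹_ur(K_q, T̄)`, `v ≠ 0`, with `τ_q v = ε • v`.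
[cite: Howard2004HeegnerKolyvagin, Lemma 1.5.3 proof (arXiv p. 10 L12–16) and Prop. 1.1.7 (p. 5 L129–138)] -/
theorem unramified_exists_eigenclass_ne_zero (hρ : ρbar.IsScalarLinear R) [Finite Nbar]
    (htriv : ∀ (σ : absoluteGaloisGroup (q.adicCompletion K)) (x : Nbar), GaloisRep.toLocal q ρbar σ x = x)
    (γ₀ : absoluteGaloisGroup (q.adicCompletion K)) (hγ₀ : IsFrobPow γ₀ 1)
    (hφγ : γ₀⁻¹ * (h ▸ cd.φ q γ₀ : absoluteGaloisGroup (q.adicCompletion K)) ∈ absInertia (q.adicCompletion K))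
    (hΘ : ∃ xp : Nbar, xp ≠ 0 ∧ A.θ (ρbar (cd.δ q) xp) = xp ∧ ∃ xm : Nbar, xm ≠ 0 ∧ A.θ (ρbar (cd.δ q) xm) = -xm ∧
      ∀ x : Nbar, ∃ a b : R, x = a • xp + b • xm)
    (hstabf : ∀ x ∈ unramifiedSubgroup (GaloisRep.toLocal q ρbar) 1, A.thetaH1 (Sum.inr q) (cd.transportH1 ρbar q
        (h.symm ▸ x : galoisCohomology (ρbar.toLocal (Sum.inr (cd.σ • q))) 1)) ∈
          unramifiedSubgroup (GaloisRep.toLocal q ρbar) 1)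
    {ε : ℤ} (hε : ε = 1 ∨ ε = -1) :
    ∃ v ∈ unramifiedSubgroup (GaloisRep.toLocal q ρbar) 1, v ≠ 0 ∧
      A.thetaH1 (Sum.inr q) (cd.transportH1 ρbar q
        (h.symm ▸ v : galoisCohomology (ρbar.toLocal (Sum.inr (cd.σ • q))) 1)) = ε • v := by
  let τ : galoisCohomology (ρbar.toLocal (Sum.inr q)) 1 →+ galoisCohomology (ρbar.toLocal (Sum.inr q)) 1 :=
    AddMonoidHom.mk' (fun y => A.thetaH1 (Sum.inr q) (cd.transportH1 ρbar q
        (h.symm ▸ y : galoisCohomology (ρbar.toLocal (Sum.inr (cd.σ • q))) 1)))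
      (A.thetaH1_transportH1_cast_add h)
  have hτ : ∀ y, τ y = A.thetaH1 (Sum.inr q) (cd.transportH1 ρbar q
      (h.symm ▸ y : galoisCohomology (ρbar.toLocal (Sum.inr (cd.σ • q))) 1)) := fun _ => rfl
  let ev : galoisCohomology (ρbar.toLocal (Sum.inr q)) 1 →+ Nbar := evalClass (GaloisRep.toLocal q ρbar) htriv γ₀
  let Θ : Nbar →ₗ[R] Nbar :=
    { toFun := fun x => A.θ (ρbar (cd.δ q) x)
      map_add' := fun x y => by rw [map_add, map_add]
      map_smul' := fun r x => by rw [hρ (cd.δ q) r x, map_smul, RingHom.id_apply] }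
  have hΘ' : ∃ xp : Nbar, xp ≠ 0 ∧ Θ xp = xp ∧ ∃ xm : Nbar, xm ≠ 0 ∧ Θ xm = -xm ∧
      ∀ x : Nbar, ∃ a b : R, x = a • xp + b • xm := hΘ
  have hinj : ∀ x ∈ unramifiedSubgroup (GaloisRep.toLocal q ρbar) 1, ev x = 0 → x = 0 :=
    fun x hx h0 => evalClass_eq_zero_of_mem_unramified (GaloisRep.toLocal q ρbar) htriv hγ₀ hx h0
  have hsurj : ∀ t : Nbar, ∃ x ∈ unramifiedSubgroup (GaloisRep.toLocal q ρbar) 1, ev x = t :=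
    fun t => exists_mem_unramified_evalClass_eq (GaloisRep.toLocal q ρbar) htriv hγ₀ t
  have hτev : ∀ x ∈ unramifiedSubgroup (GaloisRep.toLocal q ρbar) 1, ev (τ x) = (1 : ℤ) • Θ (ev x) := by
    intro x hx
    rw [hτ, one_zsmul]
    change evalClass (GaloisRep.toLocal q ρbar) htriv γ₀ _ = A.θ (ρbar (cd.δ q)
      (evalClass (GaloisRep.toLocal q ρbar) htriv γ₀ x))
    rw [A.evalClass_thetaH1_transportH1_cast h htriv γ₀,
      evalClass_eq_of_mem_unramified (GaloisRep.toLocal q ρbar) htriv hφγ hx]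
  obtain ⟨v, hv, hv0, hτv⟩ := exists_eigenvector_ne_zero_of_eval (unramifiedSubgroup (GaloisRep.toLocal q ρbar) 1)
    τ hstabf ev hinj hsurj Θ (Or.inl rfl) hτev hΘ' hε
  exact ⟨v, hv, hv0, hτv⟩

end ResidualTau

end Literature.NumberTheory.GaloisCohomology.Howard2004
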